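import Summits.QuantumFields.YangMills.Theorems.BalabanUVNodesN11RunGuardIsCouplingFloor
import Literature.MathematicalPhysics.QuantumFieldTheory.Balaban1983to89.Node00.Record13CoPH

/-!
# DAG node N11 — IN [I] THM 2's REGIME THE RUN GUARD IS ONE WORLD-LEVEL SCALAR: at a world `w` bound to the CoPH datum of `θ` (`M = L^a`, `r = 1`), a run in the `running` leaf
# ((0.31) with `g_K` pinned at `w.gR`: `Step.Discrete031 w.b w.βup`) with positive couplings is partition-compatible at every level as soon as `log(1∕gR² + βup) ≤ L^{m−a}` —
# uniformly over runs; the same from the leaves `rgFlow ∧ betaSmoothBounded ∧ betaPositive ∧ thm2Regime` (`DagBinding.thm2OfBeta_leavesP`)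

HEADER — WORK-UNIT METADATA.  Cell `pub-ymgap`, YM-PLAN Track A (HUMAN RULING D-0062 ∕ D-0149 width seats), seat `pub-ymgap-dag-n11-w4` (g4; WIDTH SEAT 4 of 4 on NODE n11
[B14]), route `BalabanUVNodes`, item K1⁷ `StabilityBAtRecordR13SepCoPH` = stmt-QuantumFields-20542 (helper lane, `--kind proof --supports 20542 --as helper`, count-neutral).
[I] = [Balaban1987RG1], [III] = [Balaban1988Convergent].  Over this seat's p611474 `…N11PartCompatOfTwoSidedRunning` (`partCompat₁₃_of_upperRunning`), p615408 `…N11RunGuardIsCouplingFloor`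
(the floor), and the tree's `DagBinding` (`leavesP`, `WorldP`, `h033LogRunning_iff_discrete031`, `thm2OfBeta_leavesP`).

WHY THIS FILE.  p615408 ∕ p617030 LOCATED: the guard `PartCompat₁₃` is a floor on the last coupling and fails on the runs of a one-sided window below it; the plan's menu includes
(β) «a floor on `g_K` in the run letter — print's renormalisation condition `g_K = g`, [I] Thm 2».  The tree ALREADY binds that regime per run: the `leavesP w P` leaves `thm2Regime :=
Thm2RegimeOf flow K γ gR` (`0 < gR ≤ γ`, `g_K = gR`, positive couplings) and `running := B14.H033LogRunning w.L w.gR (b∕log L) (βup∕log L) flow K` ((0.31) with `g = gR`), and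
`DagBinding.thm2OfBeta_leavesP` derives `smallCouplings ∧ running` from `rgFlow ∧ betaSmoothBounded ∧ betaPositive ∧ thm2Regime`.  THIS FILE shows that on THAT regime the guard
costs ONE WORLD-LEVEL SCALAR `log(1∕w.gR² + w.βup) ≤ L^{m−a}` (no per-run letter): `running` IS `Step.Discrete031 w.b w.βup K gR g` (the tree's iff), whose upper half is p611474's
hypothesis with `g := gR`, `β′ := βup∕log L`.  So if the K1 assembly asks N11's chain only on runs in [I] Thm 2's regime of the record's world (instead of the one-sided window), the
run guard is discharged once per world — count-neutral; the choice is the plan's.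

WHAT THIS FILE PROVES (0 `sorry`, 0 `def`; composition BY NAME; the leaves are HYPOTHESES).  §1 `inv_sq_le_of_discrete031` (upper half, `ℕ`-difference form) · `gR_le_of_discrete031`
(the floor `gR ≤ g_K`… as `1∕g_K² ≤ 1∕gR²`).  §2 ★★ `partCompat₁₃_of_discrete031_of_floor` (generic θ, `M = L^a`, `r = 1`: positive couplings + `Step.Discrete031 b βup K gR (gOfRecord θ p)` +
`0 < gR`, `0 ≤ βup`, `a ≤ m`, `log(1∕gR² + βup) ≤ L^{m−a}` ⇒ `PartCompat₁₃ θ p n` ∀ `n ≤ K`).  §3 at a world bound to the CoPH datum (`w.C = (datumOfRecord₁₃CoPH θ h).C`): ★★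
`partCompat₁₃_of_running_of_smallCouplings` · ★★★ `partCompat₁₃_of_thm2Regime` (from `rgFlow`, `betaSmoothBounded`, `betaPositive`, `thm2Regime` at `P` and the world scalar).

HONEST FRAMING.  Helper lane of K1⁷; count-neutral kernel bookkeeping; nothing of [I]∕[III] asserted ([I] Thm 2 is UNPROVED in print; its regime enters as the HYPOTHESIS leaf
`thm2Regime`); NOT a discharge.  N11 NOT discharged; K1⁷ NOT closed; counts unmoved (typed 28∕28 · discharged 5∕27).  R4 closes only the conditional finite-𝕋⁴ rung `BalabanLadder.UV`
of one programme at fixed `ε = L^{−K}` — NOT ℝ⁴, NOT OS, NOT a mass gap, NOT Clay.  No `sorry`, `axiom`, `def`, `instance`, `notation`.  Sources (SHAPE ∕ bookkeeping only): [I] Thm 2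
+ (0.31) p.259, (0.20) p.256; [III] (2.1) p.254, (2.5) p.255, (2.6) p.255, p.257.
-/

noncomputable section

namespace Summit.QuantumFields.YangMills.Theorems.BalabanUVNodesN11RunGuardInThm2Regime

open Literature.MathematicalPhysics.QuantumFieldTheory.Balaban1983to89 T4Continuum Node00 DagBinding
open BalabanUVNodesN11PartCompatOfTwoSidedRunning (partCompat₁₃_of_upperRunning)

/-! ## §1  The upper half of the discrete (0.31) in the `ℕ`-difference letter of p611474 -/

section Discrete

/-- The upper half of `Step.Discrete031 b β′ K gR g`: `1∕g_i² ≤ 1∕gR² + β′·(K − i)` with the difference read in `ℕ` (`i ≤ K`). [cite: Balaban1987RG1, (0.31) p.259] -/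
theorem inv_sq_le_of_discrete031 {b β' gR : ℝ} {K : ℕ} {g : ℕ → ℝ} (h : Step.Discrete031 b β' K gR g) {i : ℕ} (hi : i ≤ K) :
    1 / g i ^ 2 ≤ 1 / gR ^ 2 + β' * ((K - i : ℕ) : ℝ) := by
  have h2 := (h i hi).2
  rwa [Nat.cast_sub hi]

/-- **THE FLOOR IN THM 2's REGIME**: the upper half of (0.31) at the last level reads `1∕g_K² ≤ 1∕gR²` — the last coupling is at least the renormalised one. [cite: Balaban1987RG1, Thm 2 + (0.31) p.259] -/
theorem inv_sq_top_le_of_discrete031 {b β' gR : ℝ} {K : ℕ} {g : ℕ → ℝ} (h : Step.Discrete031 b β' K gR g) : 1 / g K ^ 2 ≤ 1 / gR ^ 2 := by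
  have h2 := (h K le_rfl).2
  simpa using h2

end Discrete

/-! ## §2  Generic θ: positive couplings + the discrete (0.31) w.r.t. `gR` + one scalar on `(gR, βup)` ⇒ the guard at every level -/

section Generic

variable {F : T4Family} {N : ℕ} [NeZero N]

/-- `0 < log L` for the family's `L > 11`. [cite: Balaban1987RG1, (0.1) p.251 (bookkeeping)] -/
private theorem log_L_pos (F : T4Family) : 0 < Real.log (F.L : ℝ) :=
  Real.log_pos (by have := F.hL11; exact_mod_cast (by omega : 1 < F.L))

/-- **★★ THE RUN GUARD FROM THE DISCRETE (0.31) AND ONE SCALAR** (generic θ with `θ.τ9.M = F.L^a`, `θ.ν.r = 1`): positive couplings along the run, `Step.Discrete031 b βup K gR g` on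
the record's couplings, `0 < gR`, `0 ≤ βup`, `a ≤ F.m` and `log(1∕gR² + βup) ≤ L^{m−a}` give `PartCompat₁₃ θ p n` for every `n ≤ K` (p611474 with `g := gR`, `β′ := βup∕log L`).
[cite: Balaban1987RG1, Thm 2 + (0.31) p.259; Balaban1988Convergent, (2.1) p.254, (2.5) p.255, p.257] -/
theorem partCompat₁₃_of_discrete031_of_floor (θ : Stage13Params F N) {a : ℕ} (hM : θ.τ9.M = F.L ^ a) (hr : θ.ν.r = 1) (p : B12.RunParams) (ha : a ≤ F.m)
    {b βup gR : ℝ} (hgR : 0 < gR) (hβ : 0 ≤ βup)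
    (hpos : ∀ i, i ≤ p.K → 0 < gOfRecord₁₃ F N θ p i) (hD : Step.Discrete031 b βup p.K gR (gOfRecord₁₃ F N θ p))
    (hfloor : Real.log (1 / gR ^ 2 + βup) ≤ ((F.L ^ (F.m - a) : ℕ) : ℝ)) {n : ℕ} (hn : n ≤ p.K) : PartCompat₁₃ F N θ p n := by
  have hlog := log_L_pos F
  have hL0 : Real.log (F.L : ℝ) ≠ 0 := hlog.ne'
  refine partCompat₁₃_of_upperRunning θ hM hr p ha (g := gR) (β' := βup / Real.log F.L) hgR (div_nonneg hβ hlog.le) (fun i hi => ⟨hpos i hi, ?_⟩) ?_ hn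
  · have h := inv_sq_le_of_discrete031 hD hi
    have heq : βup / Real.log F.L * ((p.K - i : ℕ) : ℝ) * Real.log F.L = βup * ((p.K - i : ℕ) : ℝ) := by field_simp
    rw [heq]
    exact h
  · have heq : βup / Real.log F.L * Real.log F.L = βup := by field_simp
    rw [heq]
    exact hfloor

end Generic

/-! ## §3  At a world bound to the CoPH datum: the `running` leaf, resp. [I] Thm 2's regime leaves, and ONE world-level scalar -/

section World

variable {F : T4Family} {N : ℕ} [NeZero N] {θ : Stage13HParams F N}

/-- **★★ THE RUN GUARD FROM THE `running` AND `smallCouplings` LEAVES** at a world bound to the CoPH datum of `θ` (`w.C = datum.C`; `M = L^a`, `r = 1`, `a ≤ m`, `0 < w.gR`,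
`0 ≤ w.βup`): `(leavesP w P).running` IS the discrete (0.31) w.r.t. `w.gR` (`h033LogRunning_iff_discrete031`), so the world scalar `log(1∕w.gR² + w.βup) ≤ L^{m−a}` gives
`PartCompat₁₃ θ P n` for every `n ≤ P.K` — uniformly over the runs of the regime. [cite: Balaban1987RG1, Thm 2 + (0.31) p.259; Balaban1988Convergent, (2.1) p.254, (2.5) p.255, p.257] -/
theorem partCompat₁₃_of_running_of_smallCouplings (h : θ.Provisos₁₃CoPH F N) {a : ℕ} (hM : θ.τ9.M = F.L ^ a) (hr : θ.ν.r = 1) (ha : a ≤ F.m)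
    (w : WorldP) (hC : w.C = (datumOfRecord₁₃CoPH F N θ h).C) (hgR : 0 < w.gR) (hβ : 0 ≤ w.βup)
    (hfloor : Real.log (1 / w.gR ^ 2 + w.βup) ≤ ((F.L ^ (F.m - a) : ℕ) : ℝ))
    (P : B12.RunParams) (hrun : (leavesP w P).running) (hsc : (leavesP w P).smallCouplings) {n : ℕ} (hn : n ≤ P.K) :
    PartCompat₁₃ F N θ.toStage13Params P n := by
  have hD : Step.Discrete031 w.b w.βup P.K w.gR (w.C P).flow.g :=
    (h033LogRunning_iff_discrete031 w.L w.gR w.b w.βup w.one_lt_L (w.C P).flow P.K).1 hrun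
  have hsc' : ∀ i, i ≤ P.K → 0 < (w.C P).flow.g i := fun i hi => (hsc i hi).1
  rw [hC] at hD hsc'
  exact partCompat₁₃_of_discrete031_of_floor θ.toStage13Params hM hr P ha hgR hβ (fun i hi => hsc' i hi) hD hfloor hn

/-- **★★★ THE RUN GUARD IN [I] THM 2's REGIME** at a world bound to the CoPH datum of `θ`: the leaves `rgFlow`, `betaSmoothBounded`, `betaPositive`, `thm2Regime` at `P`
(`DagBinding.thm2OfBeta_leavesP` ⇒ `smallCouplings ∧ running`) and the world scalar `log(1∕w.gR² + w.βup) ≤ L^{m−a}` give `PartCompat₁₃ θ P n` for every `n ≤ P.K`.  So on the runs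
of print's Theorem-2 regime (`g_K = gR`) the guard of the no-expansion 𝐓-step ∕ of K0's row `bg` is ONE scalar per world — the floor of p615408 at `g_K = gR`.
[cite: Balaban1987RG1, Thm 2 + (0.31) p.259, (0.20) p.256; Balaban1988Convergent, (2.1) p.254, (2.5) p.255, p.257] -/
theorem partCompat₁₃_of_thm2Regime (h : θ.Provisos₁₃CoPH F N) {a : ℕ} (hM : θ.τ9.M = F.L ^ a) (hr : θ.ν.r = 1) (ha : a ≤ F.m)
    (w : WorldP) (hC : w.C = (datumOfRecord₁₃CoPH F N θ h).C) (hgR : 0 < w.gR) (hβ : 0 ≤ w.βup)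
    (hfloor : Real.log (1 / w.gR ^ 2 + w.βup) ≤ ((F.L ^ (F.m - a) : ℕ) : ℝ))
    (P : B12.RunParams) (hrg : (leavesP w P).rgFlow) (hsb : (leavesP w P).betaSmoothBounded) (hbp : (leavesP w P).betaPositive)
    (hreg : (leavesP w P).thm2Regime) {n : ℕ} (hn : n ≤ P.K) : PartCompat₁₃ F N θ.toStage13Params P n := by
  obtain ⟨hsc, hrun⟩ := thm2OfBeta_leavesP w P hrg hsb hbp hreg
  exact partCompat₁₃_of_running_of_smallCouplings h hM hr ha w hC hgR hβ hfloor P hrun hsc hn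

end World

end Summit.QuantumFields.YangMills.Theorems.BalabanUVNodesN11RunGuardInThm2Regime

end
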